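import Mathlib

/-!
# Route `UnitScaleTilt` — crux K2-L `HistoryTailL` (stmt-QuantumFields-19936), STUB 4c `stub_diluteExponent`: THE BUDGET INEQUALITY — with `p_i = b₀x_i^{p₀}`,
# `p₀ = 2r₀ + 1`, `x_i = x_j + (j − i)·log√L`, the entropy share `σ(i,j) = (b₀²/200)·x_i^{2p₀−1}(x_i − x_j)` and the large-field-region charge
# `κZ·(j − i)·A·x_i^{1+3r₀}` of a level-`i` large plaquette fit `4d² = 36` times into the surplus `¼(p_i² − p_j²)` as soon as `x_j ≥ 515·κZ·A/(b₀²·log√L)`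
# (support file; pure real analysis)

Fleet lead `ym-ust-18916-p1` (gen 3), 2026-08-27.  The hypothesis `hbudget` of `HistoryTailDiluteCore.dilute_core` (p492897) at the stub's `σ`.

* `rpow_sub_rpow_ge` — `x^a − y^a ≥ x^{a−1}(x − y)` for `x ≥ y ≥ 1`, `a ≥ 1`;
* **`budget_ineq`** — `μ(σ + κZ·n·x_i·A·x_i^{3r₀}) ≤ ¼((b₀x_i^{p₀})² − (b₀x_j^{p₀})²)` for `μ ≤ 36`, `x_i = x_j + n·lg`, `x_j ≥ max 1 (515κZA/(b₀²lg))`.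

References: T. Bałaban, CMP 102 (1985) 255–275 [Balaban1985UV3] ((69)–(71) p.273: the surplus `p(g_i)² − p(g_j)²` of a lower large plaquette).
-/

noncomputable section

namespace Summit.QuantumFields.YangMills.Theorems.HistoryTailDiluteBudget

/-- `x^a − y^a ≥ x^{a−1}·(x − y)` for `1 ≤ y ≤ x`, `1 ≤ a` (since `x^{a−1}y ≥ y^{a−1}y = y^a`). [folklore] -/
theorem rpow_sub_rpow_ge {x y a : ℝ} (hy : 1 ≤ y) (hxy : y ≤ x) (ha : 1 ≤ a) : x ^ (a - 1) * (x - y) ≤ x ^ a - y ^ a := by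
  have hx0 : 0 < x := by linarith
  have hy0 : 0 < y := by linarith
  have h1 : x ^ a = x ^ (a - 1) * x := by
    rw [← Real.rpow_add_one hx0.ne' (a - 1)]; ring_nf
  have h2 : y ^ a = y ^ (a - 1) * y := by
    rw [← Real.rpow_add_one hy0.ne' (a - 1)]; ring_nf
  have h3 : y ^ (a - 1) ≤ x ^ (a - 1) := Real.rpow_le_rpow hy0.le hxy (by linarith)
  rw [h1, h2]
  nlinarith [Real.rpow_nonneg hx0.le (a - 1)]

/-- **THE BUDGET INEQUALITY** of the dilute-family exponent bound: for `0 < b₀`, `1 ≤ r₀`, `κZ, A ≥ 0`, `lg > 0`, `μ ≤ 36`, `x_j ≥ 1`, `x_i = x_j + n·lg`,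
`515·κZ·A/(b₀²·lg) ≤ x_j`:
`μ·((b₀²/200)·x_i^{2(2r₀+1)−1}(x_i − x_j) + κZ·(n·(x_i·(A·x_i^{3r₀})))) ≤ ((b₀x_i^{2r₀+1})² − (b₀x_j^{2r₀+1})²)/4`.
[cite: Balaban1985UV3, (69)-(71) p.273] -/
theorem budget_ineq {b₀ r₀ κZ A lg xi xj μ : ℝ} (n : ℕ) (hb : 0 < b₀) (hr : 1 ≤ r₀) (hκ : 0 ≤ κZ) (hA : 0 ≤ A) (hlg : 0 < lg)
    (hμ : μ ≤ 36) (hxj : 1 ≤ xj) (hxi : xi = xj + n * lg) (hX : 515 * κZ * A / (b₀ ^ 2 * lg) ≤ xj) :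
    μ * (b₀ ^ 2 / 200 * xi ^ (2 * (2 * r₀ + 1) - 1) * (xi - xj) + κZ * (n * (xi * (A * xi ^ (3 * r₀))))) ≤
      ((b₀ * xi ^ (2 * r₀ + 1)) ^ 2 - (b₀ * xj ^ (2 * r₀ + 1)) ^ 2) / 4 := by
  have hn0 : (0 : ℝ) ≤ n := Nat.cast_nonneg n
  have hxij : xj ≤ xi := by rw [hxi]; nlinarith
  have hxi1 : 1 ≤ xi := hxj.trans hxij
  have hxi0 : 0 < xi := by linarith
  have hxj0 : 0 < xj := by linarith
  have hb2 : 0 < b₀ ^ 2 := by positivity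
  -- squares of the p-function as real powers
  have hsq : ∀ {z : ℝ}, 0 < z → (b₀ * z ^ (2 * r₀ + 1)) ^ 2 = b₀ ^ 2 * z ^ (2 * (2 * r₀ + 1)) := by
    intro z hz
    rw [mul_pow, ← Real.rpow_natCast (z ^ (2 * r₀ + 1)) 2, ← Real.rpow_mul hz.le]
    push_cast; ring_nf
  rw [hsq hxi0, hsq hxj0]
  -- the surplus dominates `b₀² x_i^{2p₀−1}(x_i − x_j)/4`
  set a : ℝ := 2 * (2 * r₀ + 1) with ha
  have ha1 : 1 ≤ a := by rw [ha]; linarith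
  have hsur : xi ^ (a - 1) * (xi - xj) ≤ xi ^ a - xj ^ a := rpow_sub_rpow_ge hxj hxij ha1
  have hsub : xi - xj = n * lg := by rw [hxi]; ring
  -- the exponent bookkeeping: `x_i^{a−1} = x_i · x_i^{3r₀} · x_i^{r₀}`
  have hexp : xi ^ (a - 1) = xi * xi ^ (3 * r₀) * xi ^ r₀ := by
    have : a - 1 = 1 + 3 * r₀ + r₀ := by rw [ha]; ring
    rw [this, Real.rpow_add hxi0, Real.rpow_add hxi0, Real.rpow_one]
  -- `x_i^{r₀} ≥ x_i ≥ x_j ≥ 515 κZ A/(b₀² lg)`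
  have hxr : xi ≤ xi ^ r₀ := by
    calc xi = xi ^ (1 : ℝ) := (Real.rpow_one xi).symm
      _ ≤ xi ^ r₀ := Real.rpow_le_rpow_of_exponent_le hxi1 hr
  have hX' : 515 * κZ * A ≤ b₀ ^ 2 * lg * xi ^ r₀ := by
    have h1 : 515 * κZ * A ≤ xj * (b₀ ^ 2 * lg) := (div_le_iff₀ (by positivity)).mp hX
    nlinarith [mul_le_mul_of_nonneg_left (hxij.trans hxr) (by positivity : (0 : ℝ) ≤ b₀ ^ 2 * lg)]
  -- the Z-part: `36 κZ n x_i A x_i^{3r₀} ≤ 0.07 b₀² x_i^{a−1} n lg`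
  have hP0 : 0 ≤ xi * xi ^ (3 * r₀) := mul_nonneg hxi0.le (Real.rpow_nonneg hxi0.le _)
  have hZ : 36 * (κZ * (n * (xi * (A * xi ^ (3 * r₀))))) ≤ 7 / 100 * (b₀ ^ 2 * xi ^ (a - 1) * (n * lg)) := by
    rw [hexp]
    have : 36 * (κZ * (n * (xi * (A * xi ^ (3 * r₀))))) = (36 * κZ * A) * (n * (xi * xi ^ (3 * r₀))) := by ring
    rw [this]
    have : 7 / 100 * (b₀ ^ 2 * (xi * xi ^ (3 * r₀) * xi ^ r₀) * (n * lg)) = (7 / 100 * (b₀ ^ 2 * lg * xi ^ r₀)) * (n * (xi * xi ^ (3 * r₀))) := by ring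
    rw [this]
    refine mul_le_mul_of_nonneg_right ?_ (mul_nonneg hn0 hP0)
    nlinarith
  -- the σ-part: `36 (b₀²/200) = 0.18 b₀²`
  have hσ : 36 * (b₀ ^ 2 / 200 * xi ^ (a - 1) * (xi - xj)) = 18 / 100 * (b₀ ^ 2 * xi ^ (a - 1) * (xi - xj)) := by ring
  -- assemble
  have hpos1 : 0 ≤ b₀ ^ 2 / 200 * xi ^ (a - 1) * (xi - xj) + κZ * (n * (xi * (A * xi ^ (3 * r₀)))) := by
    have : 0 ≤ xi ^ (a - 1) := Real.rpow_nonneg hxi0.le _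
    have : 0 ≤ xi - xj := by linarith
    positivity
  have hrw : (2 * (2 * r₀ + 1) - 1) = a - 1 := by rw [ha]
  rw [hrw]
  calc μ * (b₀ ^ 2 / 200 * xi ^ (a - 1) * (xi - xj) + κZ * (n * (xi * (A * xi ^ (3 * r₀)))))
      ≤ 36 * (b₀ ^ 2 / 200 * xi ^ (a - 1) * (xi - xj) + κZ * (n * (xi * (A * xi ^ (3 * r₀))))) :=
        mul_le_mul_of_nonneg_right hμ hpos1
    _ = 18 / 100 * (b₀ ^ 2 * xi ^ (a - 1) * (xi - xj)) + 36 * (κZ * (n * (xi * (A * xi ^ (3 * r₀))))) := by rw [mul_add, hσ]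
    _ ≤ 18 / 100 * (b₀ ^ 2 * xi ^ (a - 1) * (xi - xj)) + 7 / 100 * (b₀ ^ 2 * xi ^ (a - 1) * (n * lg)) := by linarith [hZ]
    _ = 25 / 100 * (b₀ ^ 2 * (xi ^ (a - 1) * (xi - xj))) := by rw [← hsub]; ring
    _ ≤ 25 / 100 * (b₀ ^ 2 * (xi ^ a - xj ^ a)) := by nlinarith [mul_le_mul_of_nonneg_left hsur hb2.le]
    _ = (b₀ ^ 2 * xi ^ a - b₀ ^ 2 * xj ^ a) / 4 := by ring

end Summit.QuantumFields.YangMills.Theorems.HistoryTailDiluteBudget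

end
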